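import Summits.Parity.BatemanHorn.Theses.AlmostPrimeZeros
import Summits.Parity.BatemanHorn.Theorems.AlmostPrimeZerosSystemMomentDeficitAssembly
import Summits.Parity.BatemanHorn.Theorems.AlmostPrimeZerosSystemMomentDeficitCrtPairCount
import Summits.Parity.BatemanHorn.Theorems.AlmostPrimeZerosSystemMomentDeficitNearPairCov
import Summits.Parity.BatemanHorn.Theorems.AlmostPrimeZerosSystemMomentDeficitPrimePairTail
import Summits.Parity.BatemanHorn.Theorems.AlmostPrimeZerosSystemMomentDeficitPrimeWindow
import Summits.Parity.BatemanHorn.Theorems.AlmostPrimeZerosSystemMomentDeficitPairBookkeeping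
import Summits.Parity.BatemanHorn.Theorems.AlmostPrimeZerosSystemMomentDeficitK1OfRoughClassDeficit
import Summits.Parity.BatemanHorn.Theorems.AlmostPrimeZerosSystemMomentDeficitRCDOfRoughAPLower
import Summits.Parity.BatemanHorn.Theorems.AlmostPrimeZerosSystemMomentDeficitRoughAPLowerLinear
import HarnessLib

/-!
# Line `Ideator3Sketch` (card `logmass-projection`) — crux stmt-Parity-11326 — skeleton, lead c2 (2026-08-16)
(`Summit.Parity.BatemanHorn.Theses.AlmostPrimeZeros.SystemMomentDeficit`, route AlmostPrimeZeros, rank 4)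

Crux: for every Bateman–Horn system `f = (f₁,…,f_k)` there is `C` with `m₁(x) − v(x) ≤ C` for all
`x ≥ 2`, where `m₁`, `v` are the mean and the variance over `0 ≤ n ≤ x` of the capped statistic
`s_f(n) = Σᵢ Σ_{p^v ∥ fᵢ(n)} min(v, 2)` (values `fᵢ(n) ≤ 0` contribute `0`).

Notation (docstrings only).  `Y = x + 1`, `E g = Y⁻¹ Σ_{0 ≤ n ≤ x} g(n)`, `Cov(g, h) = E(gh) − E g · E h`,
`PP(z)` = primes `≤ z` ∪ prime squares `≤ z`, `1_{i,q}(n) = [q ∣ fᵢ(n)⁺ ≠ 0]`, `y = ⌊x^{1/4}⌋ = Nat.sqrt (Nat.sqrt x)`,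
`N(n) = s_f(n) − Σᵢ #{q ∈ PP(x) : q ∣ fᵢ(n)⁺ ≠ 0} = Σⱼ N_{fⱼ}(n) ∈ [0, K_f]` = capped count of the prime factors `> x`
and prime-square factors `> x` of the `fᵢ(n)⁺`; `W(n) = Σᵢ Σ_{q ∈ PP(y), 1_{i,q}(n)} (1 − 2Λ(q)/log y)`.

The line: `m₁ − v = (E A_z − Var A_z) + (E B − Var B) − 2Cov(A_z, A_x − A_z) − 2Cov(A_z, N)`, `z = ⌊√x⌋`;
CRT-near / hyperbola-far / same-prime pair blocks, Mertens window; `Cov(A_z, N) = Cov(A_z − A_y, N) +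
λCov(M_y, N) + Cov(W, N)` with the first two `≥ −O(1)` by positivity; K1 = `Cov(W, N) ≥ −C`.
K1 = Σ_{q ∈ PP(y)} w_q Cov_q with w_q = 1 − 2Λ(q)/log y ∈ [−1, 1] follows (bridge 1) from the per-prime-power
ONE-SIDED ORDER-OF-MAGNITUDE rough-class deficit RCD `Cov_q = Σᵢ Cov(1_{i,q}, N) ≥ −C Λ(q)/(q log x)`, and RCD
follows member by member (bridge 2) from RAL = rough values of ONE polynomial in the residue classes of prime
powers `q ≤ x^{1/4}`, one-sided: `E(N_g ; n ≡ r (q)) ≥ (1/q)E(N_g) − CΛ(q)/(q log x)`.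

STATUS (c2).  Every registered stub but ONE is a theorem of the tree and is now IMPORTED BY NAME (same namespace;
no restated `sorry` stubs remain): `stub_crtPairCount` (…CrtPairCount, p86456), `stub_nearPairCov` (…NearPairCov,
p89493), `stub_assembly` + `exists_forall_ge_two_of_threshold` (…Assembly, p91154…), `stub_primePairTail`
(…PrimePairTail, p87439), `stub_primeWindow` (…PrimeWindow, p88234), `stub_pairBookkeeping` (…PairBookkeeping,
p88537), bridge 1 `decorrelatedCovarianceBound_of_roughClassDeficit` (…K1OfRoughClassDeficit, p105789 + Aux p104415;
its `stub_`-named alias registered by c1 is …K1OfRoughClassDeficitStub, p109115), bridge 2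
`stub_roughClassDeficit_of_roughAPLower` (…RCDOfRoughAPLower, p107167), `stub_roughAPLower_linear`
(…RoughAPLowerLinear, p107164).  The crux for every all-linear system is the unconditional tree theorem
`systemMomentDeficit_of_natDegree_eq_one` (…LinearSystems, p106798), and the conditional closure
RAL(deg ≥ 2) → crux BY NAME is `systemMomentDeficit_of_roughAPLower` (…OfRoughAPLower, lead c2).
OPEN (the only `sorry` below): `stub_roughAPLower` — RAL for ONE irreducible polynomial of degree ≥ 2 (first case
`X²+1`, `q = 3`), the crux's analytic core: rough (⇔ x-friable) values of `g` in the residue classes of a growing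
prime-power modulus to relative precision `log q/log x` (any summable budget would do; fixed `q` is free only in the
summable form).  Diagnosis of leads gen-0, c1, c2 and the crux disprover: open-problem depth (Ψ_g(x, x) has no
unconditional asymptotic; Chebyshev–Hooley gives log-mass not count — intrinsic factor 2; sieve bounds lose the parity
factor; large sieve / Cauchy–Schwarz lose √log log x; degree ≥ 3: no root equidistribution to prime moduli; degree
≥ 4: even the prime-square part of `N_g` is open) — see `Lines/Ideator3Sketch.md`, `NOTES.md` of the crux directory.
-/

namespace Summit.Parity.BatemanHorn.Cruxes.SystemMomentDeficit.Ideator3Sketch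

open scoped BigOperators
open Finset Polynomial
open Literature.NumberTheory.Sieve

/-! ### The one open stub: rough values of one polynomial of degree ≥ 2 in residue classes (RAL) -/

/-- **Stub RAL (HARDEST; OPEN for degree ≥ 2; lead): rough values of ONE irreducible polynomial in the residue
classes of small prime powers, one-sided, to order of magnitude `log q/log x`.**  For `g ∈ ℤ[X]` irreducible of
degree `≥ 2` with positive leading coefficient there is `C` such that for all `x ≥ 16`, every prime power
`q ∈ PP(⌊x^{1/4}⌋)` and every residue `r < q`:  `E(N_g ; n ≡ r (mod q)) ≥ (1/q) E(N_g) − C Λ(q)/(q log x)`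
(`N_g(n)` = capped count of the prime factors `> x` and prime-square factors `> x` of `g(n)⁺`, `E` = mean over
`0 ≤ n ≤ x`).  Heuristic (Dickman/Kubilius): deviation `+O(ρ_g(q) log q/(q² log x)) ≥ 0` on non-root classes,
`−(1/q)(log q/(d log x))(1 + o(1))` on root classes — only the right ONE-SIDED ORDER OF MAGNITUDE is asked; trivial
for `q > x^{c}`.  OPEN: first case `g = X²+1`, `q = 3` (is the share of `n ≡ 0 (mod 3)` among the `n ≤ x` with
`P⁺(n²+1) > x` at least `1/3 − O(1/log x)`?).  Nothing in print controls rough/friable values of a quadratic in a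
fixed residue class to relative precision `1/log x`; for degree `≥ 3` even root equidistribution to prime moduli
is open.  This single-polynomial statement is the crux's analytic core (implies RCD, K1 and the crux by the
landed bridges; the crux for all-linear systems needs only the linear stub and is a theorem). -/
theorem stub_roughAPLower :
    ∀ g : ℤ[X], Irreducible g → 2 ≤ g.natDegree → 0 < g.leadingCoeff →
      ∃ C : ℝ, ∀ x : ℕ, 16 ≤ x →
        ∀ q ∈ (Nat.primesLE (Nat.sqrt (Nat.sqrt x)) ∪
            ((Nat.primesLE (Nat.sqrt (Nat.sqrt x))).filter
              (fun p => p ^ 2 ≤ Nat.sqrt (Nat.sqrt x))).image (fun p => p ^ 2)),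
          ∀ r : ℕ, r < q →
            1 / (q : ℝ) * ((∑ n ∈ Finset.range (x + 1),
                (((((g.eval (n : ℤ)).toNat.factorization.sum fun _ v => min v 2) : ℕ) : ℝ) -
                (#((Nat.primesLE x ∪ ((Nat.primesLE x).filter (fun p => p ^ 2 ≤ x)).image (fun p => p ^ 2)).filter
                  (fun r' => r' ∣ (g.eval (n : ℤ)).toNat ∧ (g.eval (n : ℤ)).toNat ≠ 0)) : ℝ))) / ((x : ℝ) + 1)) -
              C * ArithmeticFunction.vonMangoldt q / ((q : ℝ) * Real.log x) ≤
            (∑ n ∈ (Finset.range (x + 1)).filter (fun n : ℕ => n % q = r),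
                (((((g.eval (n : ℤ)).toNat.factorization.sum fun _ v => min v 2) : ℕ) : ℝ) -
                (#((Nat.primesLE x ∪ ((Nat.primesLE x).filter (fun p => p ^ 2 ≤ x)).image (fun p => p ^ 2)).filter
                  (fun r' => r' ∣ (g.eval (n : ℤ)).toNat ∧ (g.eval (n : ℤ)).toNat ≠ 0)) : ℝ))) / ((x : ℝ) + 1) := by
  sorry

/-! ### Composition (kernel-checked): RAL ⇒ RCD ⇒ K1 ⇒ crux BY NAME -/

/-- RAL for every irreducible `g` of positive degree and positive leading coefficient, from the two RAL stubs
(degree `1`: `stub_roughAPLower_linear`; degree `≥ 2`: `stub_roughAPLower`). -/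
theorem roughAPLower_all :
    ∀ g : ℤ[X], Irreducible g → 0 < g.natDegree → 0 < g.leadingCoeff →
      ∃ C : ℝ, ∀ x : ℕ, 16 ≤ x →
        ∀ q ∈ (Nat.primesLE (Nat.sqrt (Nat.sqrt x)) ∪
            ((Nat.primesLE (Nat.sqrt (Nat.sqrt x))).filter
              (fun p => p ^ 2 ≤ Nat.sqrt (Nat.sqrt x))).image (fun p => p ^ 2)),
          ∀ r : ℕ, r < q →
            1 / (q : ℝ) * ((∑ n ∈ Finset.range (x + 1),
                (((((g.eval (n : ℤ)).toNat.factorization.sum fun _ v => min v 2) : ℕ) : ℝ) -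
                (#((Nat.primesLE x ∪ ((Nat.primesLE x).filter (fun p => p ^ 2 ≤ x)).image (fun p => p ^ 2)).filter
                  (fun r' => r' ∣ (g.eval (n : ℤ)).toNat ∧ (g.eval (n : ℤ)).toNat ≠ 0)) : ℝ))) / ((x : ℝ) + 1)) -
              C * ArithmeticFunction.vonMangoldt q / ((q : ℝ) * Real.log x) ≤
            (∑ n ∈ (Finset.range (x + 1)).filter (fun n : ℕ => n % q = r),
                (((((g.eval (n : ℤ)).toNat.factorization.sum fun _ v => min v 2) : ℕ) : ℝ) -
                (#((Nat.primesLE x ∪ ((Nat.primesLE x).filter (fun p => p ^ 2 ≤ x)).image (fun p => p ^ 2)).filter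
                  (fun r' => r' ∣ (g.eval (n : ℤ)).toNat ∧ (g.eval (n : ℤ)).toNat ≠ 0)) : ℝ))) / ((x : ℝ) + 1) := by
  intro g hirr hdeg hlc
  by_cases h1 : g.natDegree = 1
  · exact stub_roughAPLower_linear g h1 hlc
  · exact stub_roughAPLower g hirr (by omega) hlc

/-- **RCD for every Bateman–Horn system** (bridge 2 applied to `roughAPLower_all`). -/
theorem roughClassDeficit_all :
    ∀ (k : ℕ) (f : Fin k → ℤ[X]), IsBatemanHornSystem f → ∃ C : ℝ, ∀ x : ℕ, 16 ≤ x →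
      ∀ q ∈ (Nat.primesLE (Nat.sqrt (Nat.sqrt x)) ∪
          ((Nat.primesLE (Nat.sqrt (Nat.sqrt x))).filter
            (fun p => p ^ 2 ≤ Nat.sqrt (Nat.sqrt x))).image (fun p => p ^ 2)),
        -(C * ArithmeticFunction.vonMangoldt q / ((q : ℝ) * Real.log x)) ≤
          ∑ i, ((∑ n ∈ (Finset.range (x + 1)).filter
                  (fun n : ℕ => q ∣ ((f i).eval (n : ℤ)).toNat ∧ ((f i).eval (n : ℤ)).toNat ≠ 0),
                (((∑ j, (((f j).eval (n : ℤ)).toNat.factorization.sum fun _ v => min v 2) : ℕ) : ℝ) -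
                  ((∑ j, #((Nat.primesLE x ∪ ((Nat.primesLE x).filter (fun p => p ^ 2 ≤ x)).image
                      (fun p => p ^ 2)).filter
                    (fun r => r ∣ ((f j).eval (n : ℤ)).toNat ∧ ((f j).eval (n : ℤ)).toNat ≠ 0)) : ℕ) :
                    ℝ))) /
                ((x : ℝ) + 1) -
            (#((Finset.range (x + 1)).filter
                (fun n : ℕ => q ∣ ((f i).eval (n : ℤ)).toNat ∧ ((f i).eval (n : ℤ)).toNat ≠ 0)) : ℝ) /
                ((x : ℝ) + 1) *
              ((∑ n ∈ Finset.range (x + 1),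
                  (((∑ j, (((f j).eval (n : ℤ)).toNat.factorization.sum fun _ v => min v 2) : ℕ) : ℝ) -
                    ((∑ j, #((Nat.primesLE x ∪ ((Nat.primesLE x).filter (fun p => p ^ 2 ≤ x)).image
                        (fun p => p ^ 2)).filter
                      (fun r => r ∣ ((f j).eval (n : ℤ)).toNat ∧ ((f j).eval (n : ℤ)).toNat ≠ 0)) : ℕ) :
                      ℝ))) /
                ((x : ℝ) + 1))) :=
  stub_roughClassDeficit_of_roughAPLower roughAPLower_all

/-- **K1 for every Bateman–Horn system** (`stub_decorrelatedCovarianceBound` of the gen-0 skeleton, now DERIVED: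
bridge 1 `decorrelatedCovarianceBound_of_roughClassDeficit` (landed, imported) applied to `roughClassDeficit_all`). -/
theorem decorrelatedCovarianceBound_all :
    ∀ (k : ℕ) (f : Fin k → ℤ[X]), IsBatemanHornSystem f → ∃ C : ℝ, ∀ x : ℕ, 16 ≤ x →
      -C ≤
        (∑ n ∈ Finset.range (x + 1),
            (∑ i, ∑ q ∈ (Nat.primesLE (Nat.sqrt (Nat.sqrt x)) ∪
                ((Nat.primesLE (Nat.sqrt (Nat.sqrt x))).filter
                  (fun p => p ^ 2 ≤ Nat.sqrt (Nat.sqrt x))).image (fun p => p ^ 2)).filter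
                (fun q => q ∣ ((f i).eval (n : ℤ)).toNat ∧ ((f i).eval (n : ℤ)).toNat ≠ 0),
              (1 - 2 * ArithmeticFunction.vonMangoldt q / Real.log (Nat.sqrt (Nat.sqrt x)))) *
            (((∑ i, (((f i).eval (n : ℤ)).toNat.factorization.sum fun _ v => min v 2) : ℕ) : ℝ) -
              ((∑ i, #((Nat.primesLE x ∪ ((Nat.primesLE x).filter (fun p => p ^ 2 ≤ x)).image
                  (fun p => p ^ 2)).filter
                (fun q => q ∣ ((f i).eval (n : ℤ)).toNat ∧ ((f i).eval (n : ℤ)).toNat ≠ 0)) : ℕ) : ℝ))) /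
            ((x : ℝ) + 1) -
          (∑ n ∈ Finset.range (x + 1),
              (∑ i, ∑ q ∈ (Nat.primesLE (Nat.sqrt (Nat.sqrt x)) ∪
                  ((Nat.primesLE (Nat.sqrt (Nat.sqrt x))).filter
                    (fun p => p ^ 2 ≤ Nat.sqrt (Nat.sqrt x))).image (fun p => p ^ 2)).filter
                  (fun q => q ∣ ((f i).eval (n : ℤ)).toNat ∧ ((f i).eval (n : ℤ)).toNat ≠ 0),
                (1 - 2 * ArithmeticFunction.vonMangoldt q / Real.log (Nat.sqrt (Nat.sqrt x))))) /
              ((x : ℝ) + 1) *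
            ((∑ n ∈ Finset.range (x + 1),
                (((∑ i, (((f i).eval (n : ℤ)).toNat.factorization.sum fun _ v => min v 2) : ℕ) : ℝ) -
                  ((∑ i, #((Nat.primesLE x ∪ ((Nat.primesLE x).filter (fun p => p ^ 2 ≤ x)).image
                      (fun p => p ^ 2)).filter
                    (fun q => q ∣ ((f i).eval (n : ℤ)).toNat ∧ ((f i).eval (n : ℤ)).toNat ≠ 0)) : ℕ) :
                    ℝ))) /
              ((x : ℝ) + 1)) :=
  decorrelatedCovarianceBound_of_roughClassDeficit roughClassDeficit_all

/-- **The crux `SystemMomentDeficit` (route AlmostPrimeZeros, rank 4; item stmt-Parity-11326)** — the route decl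
BY NAME: `stub_assembly` (landed, imported) fed with the landed elementary blocks `stub_crtPairCount`,
`stub_nearPairCov`, `stub_primePairTail`, `stub_primeWindow`, `stub_pairBookkeeping` (all imported by name) and with
K1 = `decorrelatedCovarianceBound_all` (RAL ⇒ RCD ⇒ K1); the threshold `x ≥ 256` is absorbed by
`exists_forall_ge_two_of_threshold` (imported). -/
theorem SystemMomentDeficit_of :
    Summit.Parity.BatemanHorn.Theses.AlmostPrimeZeros.SystemMomentDeficit := by
  unfold Summit.Parity.BatemanHorn.Theses.AlmostPrimeZeros.SystemMomentDeficit
  intro k f hf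
  obtain ⟨C, hC⟩ := stub_assembly stub_primePairTail stub_primeWindow
    (stub_nearPairCov stub_crtPairCount) stub_pairBookkeeping decorrelatedCovarianceBound_all k f hf
  exact exists_forall_ge_two_of_threshold hC

end Summit.Parity.BatemanHorn.Cruxes.SystemMomentDeficit.Ideator3Sketch
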